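import Mathlib
import Summits.Ventures.PercRepro2.Defs
import Summits.Ventures.PercRepro2.Independence
import Summits.Ventures.PercRepro2.Graph
import Summits.Ventures.PercRepro2.Exploration
import Summits.Ventures.PercRepro2.Induced
import Summits.Ventures.PercRepro2.R2PrimeThreeReduction
import Summits.Ventures.PercRepro2.YBridge
import Summits.Ventures.PercRepro2.HCov
import Summits.Ventures.PercRepro2.HCovFns
import Summits.Ventures.PercRepro2.HCovCubic
import Summits.Ventures.PercRepro2.TriDisagreement
import Summits.Ventures.PercRepro2.TriDisagreementPinned
import Summits.Ventures.PercRepro2.HubModel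
import Summits.Ventures.PercRepro2.HubLaw
import Summits.Ventures.PercRepro2.HubRootLaw
import Summits.Ventures.PercRepro2.HubConn
import Summits.Ventures.PercRepro2.HubBernstein
import Summits.Ventures.PercRepro2.HubGc
import Summits.Ventures.PercRepro2.HubKron
import Summits.Ventures.PercRepro2.HubKernelP1

/-!
# The typed hub decomposition
(blind cell PercRepro2, typer-1 g8; NIGHT3-CERT.md §11 (ii), the typed R theorem, part T1)

The typed three-copy count `typedCount F z τ K₃` (TriDisagreementPinned.lean) of the class R
splits along the root edges `rootEdges` (the edges at the two roots) and the inner edges: the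
typed triple set of `F` is the product of the typed triple sets of `F ∩ rootEdges` and
`F ∖ rootEdges` (`tset_split`), the root-bundle state only reads the root part and the inner
pattern only the inner part, so with the **root count** `rho F z τ w` (typed root triples with
root-bundle states `w = (w¹, w², w³)`) and the **inner count** `Ninner F z τ π` (typed inner
triples with inner patterns `π`):

`typedCount F z τ K₃ = Σ_w Σ_π rho w · Ninner π · K3Z(w¹, π¹, w², π², w³, π³)`
(`typedCount_eq_rho_Ninner`).  The root count is invariant under exchanging two copies on the
edges of one bundle (`rho_swap12`, `rho_swap23`: the typed constraints are copy-symmetric and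
`rootState` reads each bundle separately), hence a function `gamma F z τ k` of the profile
`k = w¹ + w² + w³` (`rho_eq_gamma`), and

`typedCount F z τ K₃ = Σ_k gamma k · Σ_π Ninner π · W^{K₃}_k(π)` (`typedCount_eq_gamma_Wtot`):
the typed count is a nonnegative combination of the pairings of the hub table with the inner
count tensor — NIGHT3-CERT.md §11 (ii), with multi-edge bundles included (no typed parallel rule).
-/

namespace Summit.Ventures.PercRepro2.Hub

open Classical

section Split

variable {V : Type*} {E : Type*} [Fintype E] [DecidableEq E] {ends : E → Sym2 V} {μ : Mark → V}

/-- The edges at the two roots, as a finset. -/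
noncomputable def rootEdges (ends : E → Sym2 V) (μ : Mark → V) : Finset E :=
  Finset.univ.filter fun e => e ∈ touches ends {μ .a₁, μ .a₂}

omit [DecidableEq E] in
/-- Membership in the root edges. -/
lemma mem_rootEdges {e : E} : e ∈ rootEdges ends μ ↔ e ∈ touches ends {μ .a₁, μ .a₂} := by
  simp [rootEdges]

/-- A triple of configurations. -/
abbrev Triple (E : Type*) := Config E × Config E × Config E

/-- The typed predicate of `typedCount`: pinned to `z` off `F`, open counts `τ` on `F`. -/
def Typed (F : Finset E) (z : Config E) (τ : E → ℕ) (t : Triple E) : Prop :=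
  (∀ e, e ∉ F → t.1 e = z e ∧ t.2.1 e = z e ∧ t.2.2 e = z e) ∧
    ∀ e ∈ F, openCount t.1 t.2.1 t.2.2 e = τ e

/-- The typed triple set. -/
noncomputable def tset (F : Finset E) (z : Config E) (τ : E → ℕ) : Finset (Triple E) :=
  Finset.univ.filter (Typed F z τ)

/-- Membership in the typed triple set. -/
lemma mem_tset {F : Finset E} {z : Config E} {τ : E → ℕ} {t : Triple E} :
    t ∈ tset F z τ ↔ Typed F z τ t := by
  simp [tset]

variable {R : Type*} [CommRing R]

/-- The typed count is the sum of the kernel over the typed triple set. -/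
lemma typedCount_eq_sum_tset (F : Finset E) (z : Config E) (τ : E → ℕ)
    (K : Config E → Config E → Config E → R) :
    typedCount F z τ K = ∑ t ∈ tset F z τ, K t.1 t.2.1 t.2.2 := by
  unfold typedCount tset
  rw [Finset.sum_filter]
  simp only [Fintype.sum_prod_type]
  refine Finset.sum_congr (Finset.ext fun _ => by simp) fun x _ =>
    Finset.sum_congr (Finset.ext fun _ => by simp) fun y _ =>
    Finset.sum_congr (Finset.ext fun _ => by simp) fun w _ => ?_
  unfold Typed
  simp only
  split_ifs <;> rfl

/-- The root projection of a configuration (the inner edges reset to `z`). -/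
noncomputable def projR (z : Config E) (x : Config E) : Config E :=
  fun e => if e ∈ rootEdges ends μ then x e else z e

/-- The inner projection of a configuration (the root edges reset to `z`). -/
noncomputable def projI (z : Config E) (x : Config E) : Config E :=
  fun e => if e ∈ rootEdges ends μ then z e else x e

/-- Merging a root part and an inner part. -/
noncomputable def merge (x' x'' : Config E) : Config E :=
  fun e => if e ∈ rootEdges ends μ then x' e else x'' e

variable (ends μ)

/-- The root projection keeps the root edges. -/
lemma projR_apply_of_mem {z x : Config E} {e : E} (he : e ∈ rootEdges ends μ) :
    projR (ends := ends) (μ := μ) z x e = x e := by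
  simp [projR, he]

/-- The root projection resets the inner edges. -/
lemma projR_apply_of_notMem {z x : Config E} {e : E} (he : e ∉ rootEdges ends μ) :
    projR (ends := ends) (μ := μ) z x e = z e := by
  simp [projR, he]

/-- The inner projection resets the root edges. -/
lemma projI_apply_of_mem {z x : Config E} {e : E} (he : e ∈ rootEdges ends μ) :
    projI (ends := ends) (μ := μ) z x e = z e := by
  simp [projI, he]

/-- The inner projection keeps the inner edges. -/
lemma projI_apply_of_notMem {z x : Config E} {e : E} (he : e ∉ rootEdges ends μ) :
    projI (ends := ends) (μ := μ) z x e = x e := by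
  simp [projI, he]

/-- The merge reads the root part on the root edges. -/
lemma merge_apply_of_mem {x' x'' : Config E} {e : E} (he : e ∈ rootEdges ends μ) :
    merge (ends := ends) (μ := μ) x' x'' e = x' e := by
  simp [merge, he]

/-- The merge reads the inner part on the inner edges. -/
lemma merge_apply_of_notMem {x' x'' : Config E} {e : E} (he : e ∉ rootEdges ends μ) :
    merge (ends := ends) (μ := μ) x' x'' e = x'' e := by
  simp [merge, he]

variable {ends μ}

/-- Merging the two projections gives the configuration back. -/
lemma merge_projR_projI (z x : Config E) :
    merge (ends := ends) (μ := μ) (projR (ends := ends) (μ := μ) z x)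
      (projI (ends := ends) (μ := μ) z x) = x := by
  funext e
  by_cases he : e ∈ rootEdges ends μ
  · rw [merge_apply_of_mem ends μ he, projR_apply_of_mem ends μ he]
  · rw [merge_apply_of_notMem ends μ he, projI_apply_of_notMem ends μ he]

/-- The root projection of a merge is the root part, when the root part is `z` off the roots. -/
lemma projR_merge {z x' x'' : Config E} (hx' : ∀ e, e ∉ rootEdges ends μ → x' e = z e) :
    projR (ends := ends) (μ := μ) z (merge (ends := ends) (μ := μ) x' x'') = x' := by
  funext e
  by_cases he : e ∈ rootEdges ends μ
  · rw [projR_apply_of_mem ends μ he, merge_apply_of_mem ends μ he]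
  · rw [projR_apply_of_notMem ends μ he, hx' e he]

/-- The inner projection of a merge is the inner part, when the inner part is `z` on the roots. -/
lemma projI_merge {z x' x'' : Config E} (hx'' : ∀ e, e ∈ rootEdges ends μ → x'' e = z e) :
    projI (ends := ends) (μ := μ) z (merge (ends := ends) (μ := μ) x' x'') = x'' := by
  funext e
  by_cases he : e ∈ rootEdges ends μ
  · rw [projI_apply_of_mem ends μ he, hx'' e he]
  · rw [projI_apply_of_notMem ends μ he, merge_apply_of_notMem ends μ he]

/-- The root projection of a triple. -/
noncomputable def projR3 (z : Config E) (t : Triple E) : Triple E :=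
  (projR (ends := ends) (μ := μ) z t.1, projR (ends := ends) (μ := μ) z t.2.1,
    projR (ends := ends) (μ := μ) z t.2.2)

/-- The inner projection of a triple. -/
noncomputable def projI3 (z : Config E) (t : Triple E) : Triple E :=
  (projI (ends := ends) (μ := μ) z t.1, projI (ends := ends) (μ := μ) z t.2.1,
    projI (ends := ends) (μ := μ) z t.2.2)

/-- Merging two triples. -/
noncomputable def merge3 (t' t'' : Triple E) : Triple E :=
  (merge (ends := ends) (μ := μ) t'.1 t''.1, merge (ends := ends) (μ := μ) t'.2.1 t''.2.1,
    merge (ends := ends) (μ := μ) t'.2.2 t''.2.2)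

/-- The open count of a merge on a root edge is that of the root part. -/
lemma openCount_merge_of_mem {t' t'' : Triple E} {e : E} (he : e ∈ rootEdges ends μ) :
    openCount (merge3 (ends := ends) (μ := μ) t' t'').1 (merge3 (ends := ends) (μ := μ) t' t'').2.1
      (merge3 (ends := ends) (μ := μ) t' t'').2.2 e = openCount t'.1 t'.2.1 t'.2.2 e := by
  simp only [openCount, merge3, merge_apply_of_mem ends μ he]

/-- The open count of a merge on an inner edge is that of the inner part. -/
lemma openCount_merge_of_notMem {t' t'' : Triple E} {e : E} (he : e ∉ rootEdges ends μ) :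
    openCount (merge3 (ends := ends) (μ := μ) t' t'').1 (merge3 (ends := ends) (μ := μ) t' t'').2.1
      (merge3 (ends := ends) (μ := μ) t' t'').2.2 e = openCount t''.1 t''.2.1 t''.2.2 e := by
  simp only [openCount, merge3, merge_apply_of_notMem ends μ he]

/-- The root projection of a typed triple is typed for the root part of `F`. -/
lemma typed_projR3 {F : Finset E} {z : Config E} {τ : E → ℕ} {t : Triple E}
    (ht : Typed F z τ t) : Typed (F ∩ rootEdges ends μ) z τ (projR3 (ends := ends) (μ := μ) z t) := by
  obtain ⟨hpin, hcount⟩ := ht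
  constructor
  · intro e he
    simp only [projR3]
    by_cases hr : e ∈ rootEdges ends μ
    · have hF : e ∉ F := fun hF => he (Finset.mem_inter.2 ⟨hF, hr⟩)
      simp only [projR_apply_of_mem ends μ hr]
      exact hpin e hF
    · simp only [projR_apply_of_notMem ends μ hr, and_self]
  · intro e he
    have hr := (Finset.mem_inter.1 he).2
    simp only [projR3, openCount, projR_apply_of_mem ends μ hr]
    exact hcount e (Finset.mem_inter.1 he).1

/-- The inner projection of a typed triple is typed for the inner part of `F`. -/
lemma typed_projI3 {F : Finset E} {z : Config E} {τ : E → ℕ} {t : Triple E}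
    (ht : Typed F z τ t) : Typed (F \ rootEdges ends μ) z τ (projI3 (ends := ends) (μ := μ) z t) := by
  obtain ⟨hpin, hcount⟩ := ht
  constructor
  · intro e he
    simp only [projI3]
    by_cases hr : e ∈ rootEdges ends μ
    · simp only [projI_apply_of_mem ends μ hr, and_self]
    · have hF : e ∉ F := fun hF => he (Finset.mem_sdiff.2 ⟨hF, hr⟩)
      simp only [projI_apply_of_notMem ends μ hr]
      exact hpin e hF
  · intro e he
    have hr := (Finset.mem_sdiff.1 he).2
    simp only [projI3, openCount, projI_apply_of_notMem ends μ hr]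
    exact hcount e (Finset.mem_sdiff.1 he).1

/-- A merge of a typed root triple and a typed inner triple is typed for `F`. -/
lemma typed_merge3 {F : Finset E} {z : Config E} {τ : E → ℕ} {t' t'' : Triple E}
    (ht' : Typed (F ∩ rootEdges ends μ) z τ t') (ht'' : Typed (F \ rootEdges ends μ) z τ t'') :
    Typed F z τ (merge3 (ends := ends) (μ := μ) t' t'') := by
  obtain ⟨hpin', hcount'⟩ := ht'
  obtain ⟨hpin'', hcount''⟩ := ht''
  constructor
  · intro e he
    simp only [merge3]
    by_cases hr : e ∈ rootEdges ends μ
    · simp only [merge_apply_of_mem ends μ hr]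
      exact hpin' e fun h => he (Finset.mem_inter.1 h).1
    · simp only [merge_apply_of_notMem ends μ hr]
      exact hpin'' e fun h => he (Finset.mem_sdiff.1 h).1
  · intro e he
    by_cases hr : e ∈ rootEdges ends μ
    · rw [openCount_merge_of_mem hr]
      exact hcount' e (Finset.mem_inter.2 ⟨he, hr⟩)
    · rw [openCount_merge_of_notMem hr]
      exact hcount'' e (Finset.mem_sdiff.2 ⟨he, hr⟩)

/-- A typed root triple is `z` off the root edges. -/
lemma typed_root_off {F : Finset E} {z : Config E} {τ : E → ℕ} {t' : Triple E}
    (ht' : Typed (F ∩ rootEdges ends μ) z τ t') :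
    ∀ e, e ∉ rootEdges ends μ → t'.1 e = z e ∧ t'.2.1 e = z e ∧ t'.2.2 e = z e :=
  fun e he => ht'.1 e fun h => he (Finset.mem_inter.1 h).2

/-- A typed inner triple is `z` on the root edges. -/
lemma typed_inner_on {F : Finset E} {z : Config E} {τ : E → ℕ} {t'' : Triple E}
    (ht'' : Typed (F \ rootEdges ends μ) z τ t'') :
    ∀ e, e ∈ rootEdges ends μ → t''.1 e = z e ∧ t''.2.1 e = z e ∧ t''.2.2 e = z e :=
  fun e he => ht''.1 e fun h => (Finset.mem_sdiff.1 h).2 he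

/-- **The typed triple set splits** along the root / inner edges: a sum over `tset F` is a double
sum over the typed root triples and the typed inner triples. -/
theorem sum_tset_split (F : Finset E) (z : Config E) (τ : E → ℕ) (G : Triple E → R) :
    ∑ t ∈ tset F z τ, G t =
      ∑ t' ∈ tset (F ∩ rootEdges ends μ) z τ, ∑ t'' ∈ tset (F \ rootEdges ends μ) z τ,
        G (merge3 (ends := ends) (μ := μ) t' t'') := by
  rw [← Finset.sum_product']
  refine Finset.sum_nbij' (fun t => (projR3 (ends := ends) (μ := μ) z t,
    projI3 (ends := ends) (μ := μ) z t)) (fun p => merge3 (ends := ends) (μ := μ) p.1 p.2)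
    ?_ ?_ ?_ ?_ ?_
  · intro t ht
    rw [mem_tset] at ht
    exact Finset.mem_product.2 ⟨mem_tset.2 (typed_projR3 ht), mem_tset.2 (typed_projI3 ht)⟩
  · intro p hp
    obtain ⟨h1, h2⟩ := Finset.mem_product.1 hp
    exact mem_tset.2 (typed_merge3 (mem_tset.1 h1) (mem_tset.1 h2))
  · intro t _
    simp only [merge3, projR3, projI3, merge_projR_projI]
  · intro p hp
    obtain ⟨h1, h2⟩ := Finset.mem_product.1 hp
    have hoff := typed_root_off (mem_tset.1 h1)
    have hon := typed_inner_on (mem_tset.1 h2)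
    simp only [projR3, projI3, merge3]
    rw [projR_merge (fun e he => (hoff e he).1), projR_merge (fun e he => (hoff e he).2.1),
      projR_merge (fun e he => (hoff e he).2.2), projI_merge (fun e he => (hon e he).1),
      projI_merge (fun e he => (hon e he).2.1), projI_merge (fun e he => (hon e he).2.2)]
  · intro t _
    simp only [merge3, projR3, projI3, merge_projR_projI]

/-- The root-bundle state of a merge is that of the root part. -/
lemma rootState_merge (x' x'' : Config E) :
    rootState ends μ (merge (ends := ends) (μ := μ) x' x'') = rootState ends μ x' := by
  refine dependsOn_rootState fun e he => ?_
  exact merge_apply_of_mem ends μ (mem_rootEdges.2 he)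

/-- The inner pattern of a merge is that of the inner part. -/
lemma innerPat_merge (x' x'' : Config E) :
    innerPat ends μ (merge (ends := ends) (μ := μ) x' x'') = innerPat ends μ x'' := by
  refine dependsOn_innerPat fun e he => ?_
  exact merge_apply_of_notMem ends μ fun h => he (mem_rootEdges.1 h)

end Split

section Counts

variable {V : Type*} {E : Type*} [Fintype E] [DecidableEq E] {ends : E → Sym2 V} {μ : Mark → V}

/-- A triple of root-bundle states. -/
abbrev WTriple := (Fin 7 → Bool) × (Fin 7 → Bool) × (Fin 7 → Bool)

/-- A triple of inner patterns. -/
abbrev PTriple := (Fin 3 → Bool) × (Fin 3 → Bool) × (Fin 3 → Bool)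

/-- The root-bundle states of a triple. -/
noncomputable def wOf (ends : E → Sym2 V) (μ : Mark → V) (t : Triple E) : WTriple :=
  (rootState ends μ t.1, rootState ends μ t.2.1, rootState ends μ t.2.2)

/-- The inner patterns of a triple. -/
noncomputable def pOf (ends : E → Sym2 V) (μ : Mark → V) (t : Triple E) : PTriple :=
  (innerPat ends μ t.1, innerPat ends μ t.2.1, innerPat ends μ t.2.2)

/-- **The root count**: typed root triples with the given root-bundle states. -/
noncomputable def rho (ends : E → Sym2 V) (μ : Mark → V) (F : Finset E) (z : Config E) (τ : E → ℕ)
    (w : WTriple) : ℕ :=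
  ((tset (F ∩ rootEdges ends μ) z τ).filter fun t => wOf ends μ t = w).card

/-- **The inner count**: typed inner triples with the given inner patterns. -/
noncomputable def Ninner (ends : E → Sym2 V) (μ : Mark → V) (F : Finset E) (z : Config E)
    (τ : E → ℕ) (π : PTriple) : ℕ :=
  ((tset (F \ rootEdges ends μ) z τ).filter fun t => pOf ends μ t = π).card

variable {R : Type*} [CommRing R]

/-- Regrouping a sum over a finset by a statistic with finitely many values. -/
lemma sum_regroup {α β : Type*} [Fintype β] [DecidableEq β] (s : Finset α) (g : α → β)
    (f : β → R) : ∑ t ∈ s, f (g t) = ∑ b, ((s.filter fun t => g t = b).card : R) * f b := by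
  rw [← Finset.sum_fiberwise s g]
  refine Finset.sum_congr rfl fun b _ => ?_
  rw [Finset.sum_congr rfl fun t ht => by rw [(Finset.mem_filter.1 ht).2], Finset.sum_const,
    nsmul_eq_mul]

/-- **The typed hub decomposition, counting form**: on the class R the typed count of `K₃` is the
double sum of the kernel of the state pairs weighted by the root and inner counts. -/
theorem typedCount_eq_rho_Ninner [DecidableEq V] {S : Type*} [Field S]
    [LinearOrder S] [IsStrictOrderedRing S] (ends : E → Sym2 V) (o a₁ a₂ a₃ b : V)
    (hinj : Function.Injective (markOf o a₁ a₂ a₃ b)) (hR : ClassR ends (markOf o a₁ a₂ a₃ b))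
    (F : Finset E) (z : Config E) (τ : E → ℕ) :
    typedCount F z τ (CovForm.K3 ends o a₁ a₂ a₃ b : Config E → Config E → Config E → S) =
      ∑ w : WTriple, ∑ π : PTriple,
        (rho ends (markOf o a₁ a₂ a₃ b) F z τ w : S) *
          ((Ninner ends (markOf o a₁ a₂ a₃ b) F z τ π : S) *
            (K3Z w.1 π.1 w.2.1 π.2.1 w.2.2 π.2.2 : S)) := by
  rw [typedCount_eq_sum_tset]
  rw [sum_tset_split (ends := ends) (μ := markOf o a₁ a₂ a₃ b)]
  have key : ∀ t' t'' : Triple E,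
      CovForm.K3 ends o a₁ a₂ a₃ b (merge3 (ends := ends) (μ := markOf o a₁ a₂ a₃ b) t' t'').1
        (merge3 (ends := ends) (μ := markOf o a₁ a₂ a₃ b) t' t'').2.1
        (merge3 (ends := ends) (μ := markOf o a₁ a₂ a₃ b) t' t'').2.2 =
      ((K3Z (wOf ends (markOf o a₁ a₂ a₃ b) t').1 (pOf ends (markOf o a₁ a₂ a₃ b) t'').1
        (wOf ends (markOf o a₁ a₂ a₃ b) t').2.1 (pOf ends (markOf o a₁ a₂ a₃ b) t'').2.1
        (wOf ends (markOf o a₁ a₂ a₃ b) t').2.2 (pOf ends (markOf o a₁ a₂ a₃ b) t'').2.2 : ℤ) : S) := by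
    intro t' t''
    rw [K3_eq hinj hR]
    simp only [merge3, rootState_merge, innerPat_merge, wOf, pOf]
  simp only [key]
  have e1 := sum_regroup (R := S) (tset (F ∩ rootEdges ends (markOf o a₁ a₂ a₃ b)) z τ)
    (wOf ends (markOf o a₁ a₂ a₃ b))
    (fun w : WTriple => ∑ t'' ∈ tset (F \ rootEdges ends (markOf o a₁ a₂ a₃ b)) z τ,
      ((K3Z w.1 (pOf ends (markOf o a₁ a₂ a₃ b) t'').1 w.2.1 (pOf ends (markOf o a₁ a₂ a₃ b) t'').2.1
        w.2.2 (pOf ends (markOf o a₁ a₂ a₃ b) t'').2.2 : ℤ) : S))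
  beta_reduce at e1
  rw [e1]
  refine Finset.sum_congr rfl fun w _ => ?_
  have e2 := sum_regroup (R := S) (tset (F \ rootEdges ends (markOf o a₁ a₂ a₃ b)) z τ)
    (pOf ends (markOf o a₁ a₂ a₃ b))
    (fun π : PTriple => ((K3Z w.1 π.1 w.2.1 π.2.1 w.2.2 π.2.2 : ℤ) : S))
  beta_reduce at e2
  rw [e2, Finset.mul_sum]
  rfl

end Counts

end Summit.Ventures.PercRepro2.Hub
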